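import Literature.AnabelianGeometry.AbsoluteAnabelian.AbsTopISemiAbsolute
import Literature.AnabelianGeometry.AbsoluteAnabelian.CoinvariantRankProofs
import Literature.AnabelianGeometry.AbsoluteAnabelian.ProfiniteRankProofs
import Literature.AnabelianGeometry.AbsoluteAnabelian.GaloisSubextensionProofs
import Literature.AnabelianGeometry.AbsoluteAnabelian.FreeProcyclicCharacterization
import HarnessLib

/-!
# [AbsTopI] Thm 2.6 (i) AS TYPED (`FundamentalExtension.Thm26i`), discharged modulo its printed inputs

S. Mochizuki, *Topics in Absolute Anabelian Geometry I: Generalities* (2012) [AbsTopI], Thm 2.6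
(i), manuscript p. 21 (lit key `paper:url-11ac98ba15fc`):

  "(i) Suppose that `k` is an FF. Then `Π` is topologically finitely generated; the natural
   surjections `Π^{ab-t} ↠ G^{ab-t}`; `G ↠ G^{ab-t}` are isomorphisms. In particular, the kernel of
   the quotient `Π ↠ G` may be characterized ["group-theoretically"] as the kernel of the quotient
   `Π ↠ Π^{ab-t}` [...]. Moreover, for every open subgroup `H ⊆ Π`, and every prime number `l`,
   `δ¹_l(H) = 1`."

and its proof, p. 23 ll. 3–7:

  "The topological finite generation portion of assertion (i) follows immediately from the fact
   that `G ≅ Ẑ`, together with the topological finite generation of `Δ` [cf. Proposition 2.2]. The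
   remainder of assertion (i) follows immediately from the fact that `T_l(A)/G = 0` [a consequence
   of the "Riemann hypothesis for abelian varieties over finite fields" — cf., e.g., [Mumf],
   p. 206]."

Proof-only companion (no definitions, no named facts) of abc-iut-L4-t4's statement file
`AbsTopISemiAbsolute.lean`, where Thm 2.6 (i) is the predicate `E.Thm26i` on an abstract extension
`1 → Δ → Π → G → 1` of profinite groups: `Π` is topologically finitely generated; `Δ` is the
intersection of the kernels of all continuous `Π → ℤ_l` (all `l`); `δ¹_l(H) = 1` for every open
`H ⊆ Π` and every prime `l`.  HERE the printed deduction is kernel-checked for EVERY abstract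
extension `E`, from the printed inputs:
* "`G ≅ Ẑ`" — `IsFreeProcyclic E.gal` (the interface predicate of `FundamentalExtension.lean`; by
  `FreeProcyclicCharacterization.lean` it says exactly `G ≃ₜ* ∏_p ℤ_p`);
* "the topological finite generation of `Δ` [Prop 2.2]" — `E.GeomTFG`, BY NAME;
* "`T_l(A)/G = 0`" for `X` and its finite étale coverings — rendered group-theoretically (no Tate
  modules in the interface): for every open `H ⊆ Π` and every prime `l`, every `H`-invariant
  continuous character `Δ ∩ H → ℤ_l` is trivial (`Hom_H(Δ_H^{ab}, ℤ_l) = Hom(T_l(A_H)/G_H, ℤ_l)`);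
  this is a HYPOTHESIS (`hT`) in existing vocabulary, not a new named fact — Weil's theorem is
  not an [IUTchI–IV]-cited item (GAP-LEDGER row filed by abc-iut-L4-t4).

Ingredients proved on the way (classical): an open subgroup of a free procyclic compact group is
free procyclic (`IsFreeProcyclic.subgroup_of_isOpen`); a free procyclic profinite group has
`δ¹_l = 1` for every `l` (`IsFreeProcyclic.freeProlRank_eq_one`); and, for an arbitrary extension,
`δ¹_l(H) = δ¹_l(G_H)` as soon as the `H`-invariant characters of `Δ ∩ H` vanish — the case `m = 0`
of abc-iut-L4-d3's `freeProlRank_le_add_of_coinvariants` ([AbsAnab] Lemma 1.1.4 (ii) machinery).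
HONEST FRAMING: [AbsTopI] is a refereed, undisputed paper; nothing here bears on [IUTchIII]
Cor. 3.12; typed ≠ proved elsewhere; the three inputs stay explicit hypotheses.
-/

noncomputable section

open Topology

namespace Literature.AnabelianGeometry.AbsoluteAnabelian

universe u

/-! ### Free procyclic groups: topological finite generation, open subgroups, `δ¹_l = 1` -/

section FreeProcyclic

variable {G : Type u} [Group G] [TopologicalSpace G] [IsTopologicalGroup G]

/-- A group with a dense cyclic subgroup `⟨g⟩` is topologically generated by `{g}`. [folklore] -/
private theorem topologicalClosure_closure_singleton_eq_top_of_dense {g : G}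
    (hg : Dense (Subgroup.zpowers g : Set G)) :
    (Subgroup.closure (({g} : Finset G) : Set G)).topologicalClosure = ⊤ := by
  apply SetLike.coe_injective
  rw [Subgroup.topologicalClosure_coe, Subgroup.coe_top, Finset.coe_singleton,
    ← Subgroup.zpowers_eq_closure, hg.closure_eq]

/-- "`G ≅ Ẑ`" is topologically finitely generated (by one element). [cite: MochizukiAbsTopI2012, §0 p.7] -/
theorem FundamentalExtension.IsFreeProcyclic.isTopologicallyFinitelyGenerated
    (h : FundamentalExtension.IsFreeProcyclic G) : IsTopologicallyFinitelyGenerated G := by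
  classical
  obtain ⟨g, hg⟩ := h.exists_dense_zpowers
  exact ⟨⟨{g}, topologicalClosure_closure_singleton_eq_top_of_dense hg⟩⟩

/-- **Open subgroups of `Ẑ` are `≅ Ẑ`.**  In a compact Hausdorff group `G` with a dense cyclic
subgroup `⟨g⟩` and an open subgroup of every positive index, an open subgroup `U` (of index `n`,
say) is `closure ⟨gⁿ⟩`, topologically generated by `gⁿ`, and `closure ⟨g^{nm}⟩ ⊆ U` is open of
index `m` in `U`. [cite: MochizukiAbsTopI2012, §0 p.7] -/
theorem FundamentalExtension.IsFreeProcyclic.subgroup_of_isOpen [T2Space G] [CompactSpace G]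
    (h : FundamentalExtension.IsFreeProcyclic G) (U : Subgroup G) (hU : IsOpen (U : Set G)) :
    FundamentalExtension.IsFreeProcyclic U := by
  classical
  obtain ⟨g, hg⟩ := h.exists_dense_zpowers
  haveI : Finite (G ⧸ U) := Subgroup.quotient_finite_of_isOpen U hU
  haveI : U.FiniteIndex := Subgroup.finiteIndex_of_finite_quotient
  obtain ⟨n, hn⟩ : ∃ n : ℕ, U.index = n := ⟨_, rfl⟩
  have hn0 : 0 < n := hn ▸ Nat.pos_of_ne_zero Subgroup.FiniteIndex.index_ne_zero
  have hUeq : U = (Subgroup.zpowers (g ^ n)).topologicalClosure :=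
    eq_closureZpowersPow_of_isOpen_of_index hg hU hn0 hn
  have hgnU : g ^ n ∈ U := by
    have h1 := Subgroup.le_topologicalClosure (Subgroup.zpowers (g ^ n)) (Subgroup.mem_zpowers _)
    rwa [← hUeq] at h1
  refine ⟨⟨⟨g ^ n, hgnU⟩, ?_⟩, fun m hm => ?_⟩
  · -- `⟨gⁿ⟩` is dense in `U = closure ⟨gⁿ⟩`
    have himg : Subtype.val '' ((Subgroup.zpowers (⟨g ^ n, hgnU⟩ : U) : Subgroup U) : Set U) =
        ((Subgroup.zpowers (g ^ n) : Subgroup G) : Set G) := by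
      rw [← Subgroup.coe_subtype, ← Subgroup.coe_map, MonoidHom.map_zpowers]
      rfl
    rw [dense_iff_closure_eq, Set.eq_univ_iff_forall]
    intro x
    rw [closure_subtype, himg, ← Subgroup.topologicalClosure_coe, ← hUeq]
    exact x.2
  · -- the open subgroup of index `n * m` of `G` lies in `U` with index `m`
    have hnm : 0 < n * m := Nat.mul_pos hn0 hm
    obtain ⟨hWo, hWi⟩ :=
      isOpen_closureZpowersPow hg hnm (h.exists_isOpen_index (n * m) hnm)
    set W := (Subgroup.zpowers (g ^ (n * m))).topologicalClosure with hW
    have hWU : W ≤ U := by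
      rw [hUeq]
      refine Subgroup.topologicalClosure_minimal _ ?_ (Subgroup.isClosed_topologicalClosure _)
      rw [Subgroup.zpowers_le, pow_mul]
      exact Subgroup.le_topologicalClosure _ (Subgroup.pow_mem _ (Subgroup.mem_zpowers _) m)
    refine ⟨W.subgroupOf U, ?_, ?_⟩
    · change IsOpen (U.subtype ⁻¹' (W : Set G))
      exact hWo.preimage continuous_subtype_val
    · have h1 := Subgroup.relIndex_mul_index hWU
      rw [hWi, hn] at h1
      have h2 : W.relIndex U * n = m * n := by rw [h1, mul_comm]
      exact Nat.eq_of_mul_eq_mul_right hn0 h2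

/-- **`δ¹_l(Ẑ) = 1`** for every prime `l`: a free procyclic profinite group is topologically
generated by one element (`δ¹_l ≤ 1`) and surjects continuously onto `ℤ_l` (the `l`-th projection
of `Ẑ ≅ ∏_p ℤ_p`). [cite: MochizukiAbsTopI2012, Thm 2.6 (i) p.21] -/
theorem FundamentalExtension.IsFreeProcyclic.freeProlRank_eq_one [T2Space G] [CompactSpace G]
    [TotallyDisconnectedSpace G] (h : FundamentalExtension.IsFreeProcyclic G)
    (l : ℕ) [hl : Fact l.Prime] : freeProlRank G l = 1 := by
  classical
  refine le_antisymm ?_ ?_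
  · obtain ⟨g, hg⟩ := h.exists_dense_zpowers
    have h1 := freeProlRank_le_card ({g} : Finset G)
      (topologicalClosure_closure_singleton_eq_top_of_dense hg) l
    simpa using h1
  · obtain ⟨e, -⟩ := h.exists_continuousMulEquiv_padicProd
    let l' : Nat.Primes := ⟨l, hl.out⟩
    -- the `l`-th projection `Ẑ → ℤ_l`, as a map to `ℤ_l¹`
    let pr : Multiplicative (∀ p : Nat.Primes, @PadicInt (p : ℕ) ⟨p.2⟩) →*
        Multiplicative (Fin 1 → ℤ_[l]) :=
      { toFun := fun x => Multiplicative.ofAdd fun _ => Multiplicative.toAdd x l'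
        map_one' := rfl
        map_mul' := fun _ _ => rfl }
    have hpr : Continuous pr :=
      continuous_ofAdd.comp (continuous_pi fun _ => (continuous_apply l').comp continuous_toAdd)
    let f : G →ₜ* Multiplicative (Fin 1 → ℤ_[l]) :=
      ⟨pr.comp e.toMonoidHom, hpr.comp e.continuous⟩
    have hf : Function.Surjective f := by
      intro y
      refine ⟨e.symm (Multiplicative.ofAdd (Pi.single l' (Multiplicative.toAdd y 0))), ?_⟩
      change pr (e (e.symm _)) = y
      rw [e.apply_symm_apply]
      change Multiplicative.ofAdd (fun _ => (Pi.single l' (Multiplicative.toAdd y 0) :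
        ∀ p : Nat.Primes, @PadicInt (p : ℕ) ⟨p.2⟩) l') = y
      rw [Pi.single_eq_same]
      apply Multiplicative.toAdd.injective
      funext i
      rw [Subsingleton.elim i 0]
      rfl
    unfold freeProlRank
    exact le_iSup₂_of_le 1 ⟨f, hf⟩ (by norm_num)

end FreeProcyclic

/-! ### The profinite completion of the trivial group is trivial (the case `m = 0` of (∗)) -/

/-- Every element of the profinite completion `(ℤ⁰)^∧` of the trivial group is `1` (the canonical
map from the one-element group has dense image). [folklore] -/
private theorem profiniteCompletion_fin_zero_eq_one
    (y : ProfiniteGrp.ProfiniteCompletion.completion (GrpCat.of (Multiplicative (Fin 0 → ℤ)))) :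
    y = 1 := by
  have hd := ProfiniteGrp.ProfiniteCompletion.denseRange (GrpCat.of (Multiplicative (Fin 0 → ℤ)))
  have h1 : ∀ x : GrpCat.of (Multiplicative (Fin 0 → ℤ)), x = 1 := fun x => by
    apply Multiplicative.toAdd.injective
    funext i
    exact Fin.elim0 i
  have hr : Set.range (ProfiniteGrp.ProfiniteCompletion.etaFn
      (GrpCat.of (Multiplicative (Fin 0 → ℤ)))) = {1} := by
    ext z
    constructor
    · rintro ⟨x, rfl⟩
      rw [h1 x]
      exact map_one (ProfiniteGrp.ProfiniteCompletion.eta (GrpCat.of (Multiplicative (Fin 0 → ℤ)))).hom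
    · rintro rfl
      exact ⟨1, map_one (ProfiniteGrp.ProfiniteCompletion.eta
        (GrpCat.of (Multiplicative (Fin 0 → ℤ)))).hom⟩
  have hcl : closure ({1} : Set (ProfiniteGrp.ProfiniteCompletion.completion
      (GrpCat.of (Multiplicative (Fin 0 → ℤ))))) = Set.univ := by
    rw [← hr]
    exact hd.closure_range
  rw [closure_singleton] at hcl
  have hy : y ∈ (Set.univ : Set (ProfiniteGrp.ProfiniteCompletion.completion
      (GrpCat.of (Multiplicative (Fin 0 → ℤ))))) := trivial
  rw [← hcl] at hy
  exact Set.mem_singleton_iff.mp hy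

namespace FundamentalExtension

variable (E : FundamentalExtension.{u})

/-! ### `δ¹_l(H) = δ¹_l(G_H)` when the `H`-invariant characters of `Δ ∩ H` vanish -/

/-- The image `G′ ⊆ G` of an open subgroup `Π′ ⊆ Π` is open (notation of [AbsAnab] Lemma 1.1.4
(ii): "for any open subgroup `Π′ ⊆ Π`, if we write `G′` for the image of `Π′` in `G`"; compact image
of finite index). [cite: MochizukiAbsAnab2004, Lemma 1.1.4 (ii) p.7] -/
theorem isOpen_aug_map_of_isOpen (H : Subgroup E.arith) (hH : IsOpen (H : Set E.arith)) :
    IsOpen ((H.map E.aug.toMonoidHom : Subgroup E.gal) : Set E.gal) := by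
  have hc : IsClosed ((H.map E.aug.toMonoidHom : Subgroup E.gal) : Set E.gal) := by
    rw [Subgroup.coe_map]
    exact ((H.isClosed_of_isOpen hH).isCompact.image (map_continuous E.aug)).isClosed
  haveI : Finite (E.arith ⧸ H) := Subgroup.quotient_finite_of_isOpen H hH
  haveI : H.FiniteIndex := Subgroup.finiteIndex_of_finite_quotient
  haveI : (H.map E.aug.toMonoidHom).FiniteIndex :=
    ⟨fun h0 => Subgroup.FiniteIndex.index_ne_zero (H := H)
      (Nat.eq_zero_of_zero_dvd (h0 ▸ Subgroup.index_map_dvd H E.aug_surjective))⟩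
  exact Subgroup.isOpen_of_isClosed_of_finiteIndex _ hc

/-- **"`T_l(A)/G = 0` ⇒ `δ¹_l(Π) = δ¹_l(G)`"**, for an open subgroup `H ⊆ Π` with image `G_H ⊆ G`:
if every `H`-invariant continuous character `Δ ∩ H → ℤ_l` is trivial, then `δ¹_l(H) = δ¹_l(G_H)` —
every continuous `H ↠ ℤ_lⁿ` kills `Δ ∩ H` (its coordinates are such characters), so factors through
`G_H`.  (The case `m = 0` of [AbsAnab] Lemma 1.1.4 (ii)'s `freeProlRank_le_add_of_coinvariants`; no
splitting needed.)  Valid for every abstract extension. [cite: MochizukiAbsTopI2012, Thm 2.6 (i) p.21] -/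
theorem freeProlRank_eq_aug_map_of_invariantCharacters_trivial (H : Subgroup E.arith)
    (hH : IsOpen (H : Set E.arith)) (l : ℕ) [Fact l.Prime]
    (hT : ∀ ψ : ↥(E.geom ⊓ H) →ₜ* Multiplicative ℤ_[l],
      (∀ g ∈ H, ∀ (d d' : ↥(E.geom ⊓ H)), (d' : E.arith) = g * d * g⁻¹ → ψ d' = ψ d) →
        ∀ d, ψ d = 1) :
    freeProlRank H l = freeProlRank (H.map E.aug.toMonoidHom) l := by
  classical
  set G' : Subgroup E.gal := H.map E.aug.toMonoidHom with hG'
  haveI : CompactSpace H := isCompact_iff_compactSpace.mp (H.isClosed_of_isOpen hH).isCompact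
  have hG'o : IsOpen (G' : Set E.gal) := E.isOpen_aug_map_of_isOpen H hH
  haveI : CompactSpace G' :=
    isCompact_iff_compactSpace.mp (G'.isClosed_of_isOpen hG'o).isCompact
  let π : H →ₜ* G' :=
    ⟨E.aug.toMonoidHom.subgroupMap H,
      continuous_induced_rng.2 ((map_continuous E.aug).comp continuous_subtype_val)⟩
  have hπ : Function.Surjective π := E.aug.toMonoidHom.subgroupMap_surjective H
  have hπval : ∀ x : H, ((π x : G') : E.gal) = E.aug x := fun x => rfl
  let D : Subgroup H := E.geom.subgroupOf H
  haveI hDn : D.Normal := E.normal_geom.subgroupOf H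
  have hD : ∀ x : H, x ∈ D ↔ π x = 1 := by
    intro x
    rw [Subgroup.mem_subgroupOf, mem_geom]
    constructor
    · intro h; apply Subtype.ext; rw [hπval]; simpa using h
    · intro h
      have := congrArg (fun y : G' => (y : E.gal)) h
      simpa [hπval] using this
  -- the quotient `q : D ↠ Ẑ⁰` of (∗) with `m = 0`: the trivial map onto the trivial group
  let q : D →ₜ* ProfiniteGrp.ProfiniteCompletion.completion
      (GrpCat.of (Multiplicative (Fin 0 → ℤ))) :=
    ⟨1, continuous_const⟩
  have hq : Function.Surjective q := fun y => ⟨1, (profiniteCompletion_fin_zero_eq_one y).symm⟩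
  -- `H`-invariant characters of `D` vanish: transport `hT` along `Δ ∩ H ≅ D`
  have hqker : ∀ ψ : D →ₜ* Multiplicative ℤ_[l],
      (∀ (g : H) (d : D), ψ ⟨g * d * g⁻¹, hDn.conj_mem _ d.2 g⟩ = ψ d) →
        ∀ d, q d = 1 → ψ d = 1 := by
    intro ψ hψ d _
    let ε : ↥(E.geom ⊓ H) →* D :=
      { toFun := fun x => ⟨⟨x.1, (Subgroup.mem_inf.mp x.2).2⟩,
          Subgroup.mem_subgroupOf.mpr (Subgroup.mem_inf.mp x.2).1⟩
        map_one' := rfl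
        map_mul' := fun _ _ => rfl }
    have hε : Continuous ε :=
      (continuous_subtype_val.subtype_mk _).subtype_mk _
    let ψ' : ↥(E.geom ⊓ H) →ₜ* Multiplicative ℤ_[l] :=
      ⟨ψ.toMonoidHom.comp ε, ψ.continuous_toFun.comp hε⟩
    have hψ' : ∀ g ∈ H, ∀ (x x' : ↥(E.geom ⊓ H)), (x' : E.arith) = g * x * g⁻¹ → ψ' x' = ψ' x := by
      intro g hg x x' hx'
      have hεx' : ε x' = ⟨(⟨g, hg⟩ : H) * ε x * (⟨g, hg⟩ : H)⁻¹, hDn.conj_mem _ (ε x).2 _⟩ := by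
        apply Subtype.ext; apply Subtype.ext
        exact hx'
      change ψ (ε x') = ψ (ε x)
      rw [hεx']
      exact hψ ⟨g, hg⟩ (ε x)
    have h1 := hT ψ' hψ' ⟨((d : H) : E.arith),
      Subgroup.mem_inf.mpr ⟨Subgroup.mem_subgroupOf.mp d.2, (d : H).2⟩⟩
    have hεd : ε ⟨((d : H) : E.arith),
        Subgroup.mem_inf.mpr ⟨Subgroup.mem_subgroupOf.mp d.2, (d : H).2⟩⟩ = d := by
      apply Subtype.ext; apply Subtype.ext; rfl
    change ψ (ε _) = 1 at h1
    rwa [hεd] at h1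
  have hle := freeProlRank_le_add_of_coinvariants π hπ D hD q hq l hqker
  simp only [Nat.cast_zero, add_zero] at hle
  exact le_antisymm hle (freeProlRank_le_of_surjective π hπ l)

/-! ### [AbsTopI] Thm 2.6 (i): the three typed clauses -/

/-- **Thm 2.6 (i), "`Π` is topologically finitely generated"** — "follows immediately from the fact
that `G ≅ Ẑ`, together with the topological finite generation of `Δ` [cf. Proposition 2.2]"
(p. 23): an extension of the topologically finitely generated `G` by the topologically finitely
generated `Δ`. [cite: MochizukiAbsTopI2012, Thm 2.6 (i) p.21] -/
theorem isTopologicallyFinitelyGenerated_arith_of_isFreeProcyclic (hG : IsFreeProcyclic E.gal)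
    (hΔ : E.GeomTFG) : IsTopologicallyFinitelyGenerated E.arith :=
  IsTopologicallyFinitelyGenerated.of_extension E.aug E.aug_surjective hΔ
    hG.isTopologicallyFinitelyGenerated

/-- **Thm 2.6 (i), "the kernel of `Π ↠ G` may be characterized as the kernel of `Π ↠ Π^{ab-t}`"**, as
typed (`Δ = ⋂_l ⋂_{φ : Π → ℤ_l} Ker φ`): `⊆` because every continuous `φ : Π → ℤ_l` kills `Δ` — its
restriction to `Δ` is a `Π`-invariant character, trivial by "`T_l(A)/G = 0`" (hypothesis `hT`) —;
`⊇` because `G ≅ Ẑ = ∏_l ℤ_l` is separated by its projections to the `ℤ_l`.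
[cite: MochizukiAbsTopI2012, Thm 2.6 (i) p.21] -/
theorem geom_eq_iInf_ker_of_isFreeProcyclic (hG : IsFreeProcyclic E.gal)
    (hT : ∀ (l : ℕ) [Fact l.Prime] (ψ : ↥(E.geom ⊓ ⊤) →ₜ* Multiplicative ℤ_[l]),
      (∀ g ∈ (⊤ : Subgroup E.arith), ∀ (d d' : ↥(E.geom ⊓ ⊤)),
        (d' : E.arith) = g * d * g⁻¹ → ψ d' = ψ d) → ∀ d, ψ d = 1) :
    E.geom = ⨅ (l : ℕ) (_ : Fact l.Prime) (φ : E.arith →ₜ* Multiplicative ℤ_[l]),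
      φ.toMonoidHom.ker := by
  refine le_antisymm ?_ ?_
  · refine le_iInf fun l => le_iInf fun hl => le_iInf fun φ => ?_
    intro x hx
    let ψ : ↥(E.geom ⊓ ⊤) →ₜ* Multiplicative ℤ_[l] :=
      ⟨φ.toMonoidHom.comp (E.geom ⊓ ⊤).subtype, φ.continuous_toFun.comp continuous_subtype_val⟩
    have hψ : ∀ g ∈ (⊤ : Subgroup E.arith), ∀ (d d' : ↥(E.geom ⊓ ⊤)),
        (d' : E.arith) = g * d * g⁻¹ → ψ d' = ψ d := by
      intro g _ d d' h
      change φ (d' : E.arith) = φ (d : E.arith)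
      rw [h, map_mul, map_mul, map_inv, mul_comm (φ g) (φ d), mul_assoc, mul_inv_cancel, mul_one]
    have h1 := hT l ψ hψ ⟨x, Subgroup.mem_inf.mpr ⟨hx, Subgroup.mem_top x⟩⟩
    rw [MonoidHom.mem_ker]
    exact h1
  · intro x hx
    obtain ⟨e⟩ := (isFreeProcyclic_iff_nonempty_continuousMulEquiv_padicProd).mp hG
    rw [mem_geom]
    apply e.injective
    rw [map_one]
    apply Multiplicative.toAdd.injective
    funext p
    haveI : Fact (p : ℕ).Prime := ⟨p.2⟩
    -- the character `Π ↠ G ≅ Ẑ ↠ ℤ_p`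
    let pr : Multiplicative (∀ q : Nat.Primes, @PadicInt (q : ℕ) ⟨q.2⟩) →*
        Multiplicative ℤ_[p] :=
      AddMonoidHom.toMultiplicative (Pi.evalAddMonoidHom (fun q : Nat.Primes => @PadicInt (q : ℕ) ⟨q.2⟩) p)
    have hpr : Continuous pr :=
      continuous_ofAdd.comp ((continuous_apply p).comp continuous_toAdd)
    let φ : E.arith →ₜ* Multiplicative ℤ_[p] :=
      ⟨pr.comp (e.toMonoidHom.comp E.aug.toMonoidHom),
        hpr.comp (e.continuous.comp (map_continuous E.aug))⟩
    have hxφ : x ∈ φ.toMonoidHom.ker :=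
      Subgroup.mem_iInf.mp (Subgroup.mem_iInf.mp (Subgroup.mem_iInf.mp hx p) ⟨p.2⟩) φ
    rw [MonoidHom.mem_ker] at hxφ
    exact congrArg Multiplicative.toAdd hxφ

/-- **Thm 2.6 (i), "for every open subgroup `H ⊆ Π`, and every prime number `l`, `δ¹_l(H) = 1`"**:
`δ¹_l(H) = δ¹_l(G_H)` by "`T_l(A_H)/G_H = 0`" (hypothesis `hT` for `H`), and `G_H`, an open subgroup
of `G ≅ Ẑ`, is itself `≅ Ẑ`, of `δ¹_l = 1`. [cite: MochizukiAbsTopI2012, Thm 2.6 (i) p.21] -/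
theorem freeProlRank_open_eq_one_of_isFreeProcyclic (hG : IsFreeProcyclic E.gal)
    (H : Subgroup E.arith) (hH : IsOpen (H : Set E.arith)) (l : ℕ) [Fact l.Prime]
    (hT : ∀ ψ : ↥(E.geom ⊓ H) →ₜ* Multiplicative ℤ_[l],
      (∀ g ∈ H, ∀ (d d' : ↥(E.geom ⊓ H)), (d' : E.arith) = g * d * g⁻¹ → ψ d' = ψ d) →
        ∀ d, ψ d = 1) :
    freeProlRank H l = 1 := by
  rw [E.freeProlRank_eq_aug_map_of_invariantCharacters_trivial H hH l hT]
  set G' : Subgroup E.gal := H.map E.aug.toMonoidHom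
  have hG'o : IsOpen (G' : Set E.gal) := E.isOpen_aug_map_of_isOpen H hH
  haveI : CompactSpace G' :=
    isCompact_iff_compactSpace.mp (G'.isClosed_of_isOpen hG'o).isCompact
  exact (hG.subgroup_of_isOpen G' hG'o).freeProlRank_eq_one l

/-- **[AbsTopI] Thm 2.6 (i) AS TYPED**, the printed deduction kernel-checked for EVERY extension
`1 → Δ → Π → G → 1` of profinite groups: GIVEN
(a) "`G ≅ Ẑ`" (`IsFreeProcyclic E.gal`; print: `k` an FF),
(b) `Δ` topologically finitely generated ([AbsTopI] Prop 2.2, `E.GeomTFG`), and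
(c) the group-theoretic content of "`T_l(A)/G = 0`" [Riemann hypothesis for abelian varieties over
    finite fields] for `X` and its finite étale coverings: for every open `H ⊆ Π` and every prime
    `l`, every `H`-invariant continuous character `Δ ∩ H → ℤ_l` is trivial,
the predicate `E.Thm26i` holds: `Π` is topologically finitely generated, `Δ` is the common kernel
of the continuous `Π → ℤ_l`, and `δ¹_l(H) = 1` for every open `H ⊆ Π` and every prime `l`.
[cite: MochizukiAbsTopI2012, Thm 2.6 (i) p.21] -/
theorem thm26i_of_isFreeProcyclic (hG : IsFreeProcyclic E.gal) (hΔ : E.GeomTFG)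
    (hT : ∀ (H : Subgroup E.arith), IsOpen (H : Set E.arith) → ∀ (l : ℕ) [Fact l.Prime]
      (ψ : ↥(E.geom ⊓ H) →ₜ* Multiplicative ℤ_[l]),
      (∀ g ∈ H, ∀ (d d' : ↥(E.geom ⊓ H)), (d' : E.arith) = g * d * g⁻¹ → ψ d' = ψ d) →
        ∀ d, ψ d = 1) :
    E.Thm26i := by
  refine ⟨E.isTopologicallyFinitelyGenerated_arith_of_isFreeProcyclic hG hΔ, ?_, ?_⟩
  · refine E.geom_eq_iInf_ker_of_isFreeProcyclic hG fun l _ ψ hψ => ?_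
    exact hT ⊤ (by rw [Subgroup.coe_top]; exact isOpen_univ) l ψ hψ
  · intro H hH l _
    exact E.freeProlRank_open_eq_one_of_isFreeProcyclic hG H hH l (hT H hH l)

end FundamentalExtension

end Literature.AnabelianGeometry.AbsoluteAnabelian
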